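import Summits.HodgeConjecture.HodgeConjecture.Theorems.CyclicUnitaryPowersFermatAffineEigenfunctionsRoots

/-!
# Programme PG-FERMAT, brick F3 (part 2/3): descent along `(y₀, y₁)` — invariant holomorphic functions of polynomial growth on the affine
# Fermat surface are polynomials in `(y₀, y₁)`

Prover seat `hodge-nonav-prover-Bx` (g10), cell `hodge-nonav`, programme PG-FERMAT (memo `PROGRAMME-PG-FERMAT-Bx-g10.md`, evidence #48 on
stmt-HodgeConjecture-19544): after `CyclicUnitaryPowersK1OfFermatGenusLe` the binder PG of crux K1-A `VeryGeneralDeckCommutatorsInHg` (route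
`HodgeConjecture/CyclicUnitaryPowers`) is reduced to `h^{2,0}(X²_p) ≤ C(p−1,3)` for the Fermat surface of prime degree `p ≥ 5`, i.e. to the vanishing
of the holomorphic `2`-forms in the `μ_p⁴`-eigenlines with `|α| = 2`; on the affine piece these are `g · Res(x₃^{p−4}Ω/F)` with `g` a holomorphic
`μ_p³`-eigenfunction of polynomial growth on the affine Fermat surface `U = {y ∈ ℂ³ : y₀^p + y₁^p + y₂^p = −1}`. The three files
`CyclicUnitaryPowersFermatAffineEigenfunctions{Roots,Descent,}` prove the purely ANALYTIC statement (no Hodge theory, no schemes; Mathlib + the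
tree's several-complex-variables library `Literature/Analysis/Complex/{RiemannExtension, PolynomialGrowthLiouvilleSCV, BranchedCoveringCharPolySCV}`).
Sources of the method: J.-P. Serre, GAGA (1956) n° 19–20; L. Hörmander (1973) Thm. 2.2.7; T. Shioda, Math. Ann. 245 (1979) §1.
Sorry-free; no definition, no named fact; helper (`--supports … --as helper`); nothing here says HC ∕ HC_AV is proved.

* `sum_pow_three_eq`, `sum_pow_snoc`, `norm_snoc_le`, `norm_root_le` — bookkeeping on `ℂ³ = ℂ² × ℂ` (`‖w‖ ≤ 1 + 2‖a‖` on the fibre over `a`).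
* **`exists_mvPolynomial_of_invariant_of_growth`** — for `H` on `U` locally the restriction of holomorphic functions, invariant under
  `y₂ ↦ ζ y₂` and of growth `(1+|y|)^K`: `H(y) = P(y₀, y₁)` on `U` with `deg P ≤ K` (descent: `h(a) = H(a, ρ)` is holomorphic off the branch
  curve `a₀^p + a₁^p = −1` by local roots, locally bounded, hence entire by Riemann's extension theorem (`SCV.exists_differentiableOn_eqOn_of_thin`)
  and equal to `h` on the curve by continuity (the root tends to `0`); Liouville with polynomial growth (`exists_mvPolynomial_of_growth`)).
-/

noncomputable section

set_option linter.dupNamespace false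

open Complex Set Filter Metric Function
open scoped Topology

namespace Summit.HodgeConjecture.HodgeConjecture.Theorems.CyclicUnitaryPowersFermatAffineEigenfunctions

open Literature.Analysis.Complex

/-! ### §2 Descent along `(y₀, y₁)`: invariant holomorphic functions of polynomial growth on the affine Fermat surface are polynomials -/

section Descent

variable {p : ℕ}

/-- The `p`-th powers of the first two coordinates of a point of `ℂ³`, summed: `Σ_{i<3} zᵢ^p = Σ_{j<2} z_j^p + z₂^p`. -/
theorem sum_pow_three_eq (z : Fin 3 → ℂ) (p : ℕ) :
    ∑ i, z i ^ p = ∑ j : Fin 2, z (Fin.castSucc j) ^ p + z (Fin.last 2) ^ p :=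
  Fin.sum_univ_castSucc (f := fun i ↦ z i ^ p)

/-- `Σ_{i<3} (snoc a w)ᵢ^p = Σ_j a_j^p + w^p`. -/
theorem sum_pow_snoc (a : Fin 2 → ℂ) (w : ℂ) (p : ℕ) :
    ∑ i, (Fin.snoc a w : Fin 3 → ℂ) i ^ p = ∑ j, a j ^ p + w ^ p := by
  rw [sum_pow_three_eq]
  simp only [Fin.snoc_castSucc, Fin.snoc_last]

/-- The sup norm of `snoc a w` is bounded by `‖a‖ ⊔ ‖w‖`-type estimates: `‖snoc a w‖ ≤ M` if `‖a‖ ≤ M` and `‖w‖ ≤ M`. -/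
theorem norm_snoc_le {a : Fin 2 → ℂ} {w : ℂ} {M : ℝ} (hM : 0 ≤ M) (ha : ‖a‖ ≤ M) (hw : ‖w‖ ≤ M) :
    ‖(Fin.snoc a w : Fin 3 → ℂ)‖ ≤ M := by
  refine (pi_norm_le_iff_of_nonneg hM).mpr fun i ↦ ?_
  refine Fin.lastCases ?_ (fun j ↦ ?_) i
  · rw [Fin.snoc_last]
    exact hw
  · rw [Fin.snoc_castSucc]
    exact (norm_le_pi_norm a j).trans ha

/-- **A fibre coordinate is controlled by the base**: if `w^p = −1 − Σ_j a_j^p` (`p ≥ 1`) then `‖w‖ ≤ 1 + 2‖a‖`. -/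
theorem norm_root_le (hp : 1 ≤ p) {a : Fin 2 → ℂ} {w : ℂ} (hw : w ^ p = -1 - ∑ j, a j ^ p) : ‖w‖ ≤ 1 + 2 * ‖a‖ := by
  have hp0 : p ≠ 0 := by omega
  have hsum : ‖∑ j, a j ^ p‖ ≤ 2 * ‖a‖ ^ p := by
    calc ‖∑ j, a j ^ p‖ ≤ ∑ j, ‖a j ^ p‖ := norm_sum_le _ _
      _ ≤ ∑ _j : Fin 2, ‖a‖ ^ p := Finset.sum_le_sum fun j _ ↦ by
          rw [norm_pow]
          exact pow_le_pow_left₀ (norm_nonneg _) (norm_le_pi_norm a j) p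
      _ = 2 * ‖a‖ ^ p := by simp [two_mul]
  have h2p : (2 : ℝ) ≤ 2 ^ p := by
    calc (2 : ℝ) = 2 ^ 1 := by norm_num
      _ ≤ 2 ^ p := pow_le_pow_right₀ (by norm_num) hp
  have h1 : ‖w‖ ^ p ≤ (1 + 2 * ‖a‖) ^ p := by
    rw [← norm_pow, hw]
    calc ‖-1 - ∑ j, a j ^ p‖ ≤ ‖(-1 : ℂ)‖ + ‖∑ j, a j ^ p‖ := norm_sub_le _ _
      _ ≤ 1 + 2 * ‖a‖ ^ p := by rw [norm_neg, norm_one]; linarith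
      _ ≤ 1 ^ p + (2 * ‖a‖) ^ p := by
          rw [one_pow, mul_pow]
          have : 0 ≤ ‖a‖ ^ p := by positivity
          nlinarith
      _ ≤ (1 + 2 * ‖a‖) ^ p := pow_add_pow_le zero_le_one (by positivity) hp0
  exact (pow_le_pow_iff_left₀ (norm_nonneg _) (by positivity) hp0).mp h1

/-- **Descent and Liouville on the affine Fermat surface.** Let `p ≥ 1`, `U = {y ∈ ℂ³ : y₀^p + y₁^p + y₂^p = −1}` and `H : ℂ³ → ℂ` such that
(i) near every point of `U`, `H` agrees on `U` with a holomorphic function, (ii) `H(y₀, y₁, ζ y₂) = H(y)` on `U` for `ζ^p = 1`, and (iii)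
`|H(y)| ≤ C (1 + |y|)^K` on `U`. Then there is a polynomial `P ∈ ℂ[X₀, X₁]` of total degree `≤ K` with `H(y) = P(y₀, y₁)` on `U`.
Proof: `h(a) := H(a, ρ)` for any root `ρ^p = −1 − a₀^p − a₁^p` is well defined by (ii), holomorphic off the branch curve
`A = {a₀^p + a₁^p = −1}` (local holomorphic roots), locally bounded (iii), hence extends to an entire function (Riemann extension across the
thin set `A`) which still equals `h` on `A` (continuity: the root tends to `0` there); Liouville with polynomial growth makes it a polynomial. -/
theorem exists_mvPolynomial_of_invariant_of_growth (hp : 1 ≤ p) {H : (Fin 3 → ℂ) → ℂ}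
    (hhol : ∀ z : Fin 3 → ℂ, ∑ i, z i ^ p = -1 → ∃ W : Set (Fin 3 → ℂ), IsOpen W ∧ z ∈ W ∧
      ∃ G : (Fin 3 → ℂ) → ℂ, DifferentiableOn ℂ G W ∧ ∀ y ∈ W, ∑ i, y i ^ p = -1 → G y = H y)
    (hinv : ∀ z : Fin 3 → ℂ, ∑ i, z i ^ p = -1 → ∀ ζ : ℂ, ζ ^ p = 1 →
      H (Function.update z (Fin.last 2) (ζ * z (Fin.last 2))) = H z)
    {C : ℝ} {K : ℕ} (hgr : ∀ z : Fin 3 → ℂ, ∑ i, z i ^ p = -1 → ‖H z‖ ≤ C * (1 + ‖z‖) ^ K) :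
    ∃ P : MvPolynomial (Fin 2) ℂ, P.totalDegree ≤ K ∧
      ∀ z : Fin 3 → ℂ, ∑ i, z i ^ p = -1 → MvPolynomial.eval (fun j ↦ z (Fin.castSucc j)) P = H z := by
  classical
  have hp0 : 0 < p := hp
  -- a chosen root over every base point, and the lift
  have hfib : ∀ a : Fin 2 → ℂ, ∃ w : ℂ, w ^ p = -1 - ∑ j, a j ^ p := fun a ↦ IsAlgClosed.exists_pow_nat_eq _ hp0
  choose root hroot using hfib
  set lift : (Fin 2 → ℂ) → (Fin 3 → ℂ) := fun a ↦ Fin.snoc a (root a) with hlift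
  have hliftU : ∀ a, ∑ i, lift a i ^ p = -1 := fun a ↦ by
    rw [hlift, sum_pow_snoc, hroot]; ring
  set h : (Fin 2 → ℂ) → ℂ := fun a ↦ H (lift a) with hh
  -- (ii) ⇒ `H` is constant on the fibres: `H z = h (π z)` on `U`
  have hfibre : ∀ z : Fin 3 → ℂ, ∑ i, z i ^ p = -1 → H z = h (fun j ↦ z (Fin.castSucc j)) := by
    intro z hz
    set a : Fin 2 → ℂ := fun j ↦ z (Fin.castSucc j) with ha
    have hzp : z (Fin.last 2) ^ p = root a ^ p := by
      rw [hroot, eq_sub_iff_add_eq, ← hz, sum_pow_three_eq]; ring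
    have hz_eq : z = Fin.snoc a (z (Fin.last 2)) := by
      rw [ha]; exact (Fin.snoc_init_self z).symm
    by_cases hr : root a = 0
    · have hz0 : z (Fin.last 2) = 0 := by
        rw [hr, zero_pow (by omega)] at hzp
        exact pow_eq_zero_iff (by omega) |>.mp hzp
      show H z = H (lift a)
      congr 1
      rw [hz_eq, hz0]
      simp only [hlift, hr]
    · set ζ := z (Fin.last 2) / root a with hζ
      have hζp : ζ ^ p = 1 := by rw [hζ, div_pow, hzp, div_self (pow_ne_zero _ hr)]
      have hupd : Function.update (lift a) (Fin.last 2) (ζ * lift a (Fin.last 2)) = z := by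
        rw [hz_eq]
        ext i
        refine Fin.lastCases ?_ (fun j ↦ ?_) i
        · simp only [Function.update_self, Fin.snoc_last, hlift]
          rw [hζ, div_mul_cancel₀ _ hr]
        · rw [Function.update_of_ne (Fin.castSucc_lt_last j).ne]
          simp [hlift]
      show H z = H (lift a)
      rw [← hinv (lift a) (hliftU a) ζ hζp, hupd]
  -- the branch curve
  set A : Set (Fin 2 → ℂ) := {a | ∑ j, a j ^ p = -1} with hA
  set δ : MvPolynomial (Fin 2) ℂ := ∑ j, MvPolynomial.X j ^ p + 1 with hδ
  have hδeval : ∀ a : Fin 2 → ℂ, MvPolynomial.eval a δ = ∑ j, a j ^ p + 1 := fun a ↦ by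
    simp [hδ]
  have hδ0 : δ ≠ 0 := by
    intro h0
    have := hδeval 0
    rw [h0, map_zero] at this
    simp [zero_pow (by omega : p ≠ 0)] at this
  have hAclosed : IsClosed A := by
    have : A = (fun a : Fin 2 → ℂ ↦ ∑ j, a j ^ p) ⁻¹' {-1} := rfl
    rw [this]
    exact isClosed_singleton.preimage (by fun_prop)
  have hthin : ∀ a ∈ A ∩ univ, ∃ (φ : (Fin 2 → ℂ) → ℂ) (W : Set (Fin 2 → ℂ)), IsOpen W ∧ a ∈ W ∧ W ⊆ univ ∧
      DifferentiableOn ℂ φ W ∧ (∀ x ∈ A ∩ W, φ x = 0) ∧ ¬ φ =ᶠ[𝓝 a] 0 := by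
    intro a _
    refine ⟨fun a ↦ MvPolynomial.eval a δ, univ, isOpen_univ, mem_univ a, subset_rfl,
      (BranchedCoveringSCV.differentiable_eval δ).differentiableOn, fun x hx ↦ ?_, fun hev ↦ hδ0 ?_⟩
    · show MvPolynomial.eval x δ = 0
      rw [hδeval]
      have : ∑ j, x j ^ p = -1 := hx.1
      rw [this]; ring
    · exact BranchedCoveringSCV.eq_zero_of_eventuallyEq_zero hev
  -- `h` is holomorphic off `A`
  have hdiff : DifferentiableOn ℂ h (univ \ A) := by
    intro a ha
    have haA : ∑ j, a j ^ p ≠ -1 := fun h ↦ ha.2 h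
    have hw₀ : -1 - ∑ j, a j ^ p ≠ 0 := by
      intro h0; apply haA; linear_combination -h0
    obtain ⟨V, hVo, hw₀V, ρ, hρ, hρa, hρp⟩ := exists_local_root hp hw₀ (hroot a)
    obtain ⟨W, hWo, hzW, G, hG, hGH⟩ := hhol (lift a) (hliftU a)
    -- the holomorphic lift near `a`
    set q : (Fin 2 → ℂ) → ℂ := fun b ↦ -1 - ∑ j, b j ^ p with hq
    have hqdiff : Differentiable ℂ q := by
      have : q = fun b ↦ -MvPolynomial.eval b δ := by
        funext b
        rw [hδeval]
        show -1 - ∑ j, b j ^ p = -(∑ j, b j ^ p + 1)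
        ring
      rw [this]
      exact (BranchedCoveringSCV.differentiable_eval δ).neg
    set lift' : (Fin 2 → ℂ) → (Fin 3 → ℂ) := fun b ↦ Fin.snoc b (ρ (q b)) with hlift'
    have hlift'a : lift' a = lift a := by
      simp only [hlift', hlift, hq, hρa]
    have hρcont : ContinuousAt ρ (q a) := (hρ.differentiableAt (hVo.mem_nhds hw₀V)).continuousAt
    have hlift'diff : DifferentiableAt ℂ lift' a := by
      rw [differentiableAt_pi]
      intro i
      refine Fin.lastCases ?_ (fun j ↦ ?_) i
      · have : (fun b ↦ lift' b (Fin.last 2)) = fun b ↦ ρ (q b) := by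
          funext b
          show (Fin.snoc b (ρ (q b)) : Fin 3 → ℂ) (Fin.last 2) = ρ (q b)
          rw [Fin.snoc_last]
        rw [this]
        exact (hρ.differentiableAt (hVo.mem_nhds hw₀V)).comp a (hqdiff a)
      · have : (fun b ↦ lift' b (Fin.castSucc j)) = fun b ↦ b j := by
          funext b
          show (Fin.snoc b (ρ (q b)) : Fin 3 → ℂ) (Fin.castSucc j) = b j
          rw [Fin.snoc_castSucc]
        rw [this]
        exact (ContinuousLinearMap.proj (R := ℂ) (φ := fun _ : Fin 2 ↦ ℂ) j).differentiableAt
    have hlift'cont : ContinuousAt lift' a := hlift'diff.continuousAt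
    -- near `a`: `q b ∈ V` and `lift' b ∈ W`
    have hev1 : ∀ᶠ b in 𝓝 a, q b ∈ V := hqdiff.continuous.continuousAt.preimage_mem_nhds (hVo.mem_nhds hw₀V)
    have hev2 : ∀ᶠ b in 𝓝 a, lift' b ∈ W := hlift'cont.preimage_mem_nhds (hWo.mem_nhds (by rw [hlift'a]; exact hzW))
    have heq : h =ᶠ[𝓝 a] fun b ↦ G (lift' b) := by
      filter_upwards [hev1, hev2] with b hb1 hb2
      have hU' : ∑ i, lift' b i ^ p = -1 := by
        rw [hlift', sum_pow_snoc, hρp _ hb1, hq]; ring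
      rw [hGH _ hb2 hU', hfibre _ hU']
      simp [hlift']
    refine (DifferentiableAt.congr_of_eventuallyEq ?_ heq).differentiableWithinAt
    exact (hG.differentiableAt (hWo.mem_nhds (by rw [hlift'a]; exact hzW))).comp a hlift'diff
  -- local boundedness (everywhere, from the growth bound)
  have hC : ∀ z : Fin 3 → ℂ, ∑ i, z i ^ p = -1 → ‖H z‖ ≤ max C 0 * (1 + ‖z‖) ^ K := fun z hz ↦
    (hgr z hz).trans (mul_le_mul_of_nonneg_right (le_max_left _ _) (by positivity))
  have hgrh : ∀ a, ‖h a‖ ≤ max C 0 * 2 ^ K * (1 + ‖a‖) ^ K := by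
    intro a
    have h1 : ‖lift a‖ ≤ 1 + 2 * ‖a‖ :=
      norm_snoc_le (by positivity) (by linarith [norm_nonneg a]) (norm_root_le hp (hroot a))
    calc ‖h a‖ = ‖H (lift a)‖ := rfl
      _ ≤ max C 0 * (1 + ‖lift a‖) ^ K := hC _ (hliftU a)
      _ ≤ max C 0 * (2 * (1 + ‖a‖)) ^ K := by
          refine mul_le_mul_of_nonneg_left (pow_le_pow_left₀ (by positivity) (by linarith) K) (le_max_right _ _)
      _ = max C 0 * 2 ^ K * (1 + ‖a‖) ^ K := by rw [mul_pow]; ring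
  have hbdd : ∀ x ∈ A ∩ univ, ∃ W ∈ 𝓝 x, ∃ C' : ℝ, ∀ y ∈ W \ A, ‖h y‖ ≤ C' := by
    intro x _
    refine ⟨closedBall x 1, closedBall_mem_nhds x one_pos, max C 0 * 2 ^ K * (2 + ‖x‖) ^ K, fun y hy ↦ ?_⟩
    have hy1 : ‖y‖ ≤ ‖x‖ + 1 := by
      have := mem_closedBall.mp hy.1
      calc ‖y‖ = ‖x + (y - x)‖ := by rw [add_sub_cancel]
        _ ≤ ‖x‖ + ‖y - x‖ := norm_add_le _ _
        _ ≤ ‖x‖ + 1 := by rw [← dist_eq_norm]; linarith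
    calc ‖h y‖ ≤ max C 0 * 2 ^ K * (1 + ‖y‖) ^ K := hgrh y
      _ ≤ max C 0 * 2 ^ K * (2 + ‖x‖) ^ K :=
          mul_le_mul_of_nonneg_left (pow_le_pow_left₀ (by positivity) (by linarith) K) (by positivity)
  -- Riemann extension across the thin set `A`
  obtain ⟨ĥ, hĥ, hĥh⟩ := SCV.exists_differentiableOn_eqOn_of_thin (f := h) (U := univ) (A := A)
    (isOpen_univ.sdiff hAclosed) hthin hdiff hbdd
  -- `ĥ = h` everywhere: on `A` by continuity (the root tends to `0` there)
  have hcontA : ∀ a ∈ A, ContinuousAt h a := by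
    intro a haA
    have hra : root a = 0 := by
      have : root a ^ p = 0 := by rw [hroot]; have : ∑ j, a j ^ p = -1 := haA; rw [this]; ring
      exact pow_eq_zero_iff (by omega) |>.mp this
    -- `lift` is continuous at `a`
    have hq_tend : Tendsto (fun b : Fin 2 → ℂ ↦ -1 - ∑ j, b j ^ p) (𝓝 a) (𝓝 0) := by
      have hc : Continuous fun b : Fin 2 → ℂ ↦ -1 - ∑ j, b j ^ p := by fun_prop
      have := hc.continuousAt (x := a)
      have h0 : -1 - ∑ j, a j ^ p = 0 := by have : ∑ j, a j ^ p = -1 := haA; rw [this]; ring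
      rwa [ContinuousAt, h0] at this
    have hroot_tend : Tendsto root (𝓝 a) (𝓝 0) := by
      rw [tendsto_zero_iff_norm_tendsto_zero]
      rw [Metric.tendsto_nhds] at hq_tend ⊢
      intro ε hε
      filter_upwards [hq_tend (ε ^ p) (by positivity)] with b hb
      rw [dist_zero_right, Real.norm_of_nonneg (norm_nonneg _)]
      rw [dist_zero_right] at hb
      have : ‖root b‖ ^ p < ε ^ p := by rw [← norm_pow, hroot]; exact hb
      exact lt_of_pow_lt_pow_left₀ p hε.le this
    have hlift_tend : Tendsto lift (𝓝 a) (𝓝 (lift a)) := by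
      rw [tendsto_pi_nhds]
      intro i
      refine Fin.lastCases ?_ (fun j ↦ ?_) i
      · have e1 : (fun b ↦ lift b (Fin.last 2)) = root := by
          funext b
          show (Fin.snoc b (root b) : Fin 3 → ℂ) (Fin.last 2) = root b
          rw [Fin.snoc_last]
        have e2 : lift a (Fin.last 2) = 0 := by
          show (Fin.snoc a (root a) : Fin 3 → ℂ) (Fin.last 2) = 0
          rw [Fin.snoc_last, hra]
        rw [e1, e2]
        exact hroot_tend
      · have e1 : (fun b ↦ lift b (Fin.castSucc j)) = fun b ↦ b j := by
          funext b
          show (Fin.snoc b (root b) : Fin 3 → ℂ) (Fin.castSucc j) = b j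
          rw [Fin.snoc_castSucc]
        have e2 : lift a (Fin.castSucc j) = a j := by
          show (Fin.snoc a (root a) : Fin 3 → ℂ) (Fin.castSucc j) = a j
          rw [Fin.snoc_castSucc]
        rw [e1, e2]
        exact (continuous_apply j).continuousAt
    obtain ⟨W, hWo, hzW, G, hG, hGH⟩ := hhol (lift a) (hliftU a)
    have hGcont : ContinuousAt G (lift a) := (hG.differentiableAt (hWo.mem_nhds hzW)).continuousAt
    have hev : ∀ᶠ b in 𝓝 a, lift b ∈ W := hlift_tend (hWo.mem_nhds hzW)
    have heq : h =ᶠ[𝓝 a] fun b ↦ G (lift b) := by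
      filter_upwards [hev] with b hb
      exact (hGH _ hb (hliftU b)).symm
    refine (ContinuousAt.congr ?_ heq.symm)
    exact hGcont.tendsto.comp hlift_tend
  have hdense : (univ : Set (Fin 2 → ℂ)) ⊆ closure (univ \ A) := SCV.subset_closure_diff_of_thin isOpen_univ hthin
  have hall : ∀ a, ĥ a = h a := by
    intro a
    by_cases haA : a ∈ A
    · -- both sides are limits along the dense set `univ \ A`
      have hne : (𝓝[univ \ A] a).NeBot := mem_closure_iff_nhdsWithin_neBot.mp (hdense (mem_univ a))
      have h1 : Tendsto ĥ (𝓝[univ \ A] a) (𝓝 (ĥ a)) :=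
        ((hĥ.differentiableAt (univ_mem)).continuousAt.tendsto).mono_left nhdsWithin_le_nhds
      have h2 : Tendsto h (𝓝[univ \ A] a) (𝓝 (h a)) := ((hcontA a haA).tendsto).mono_left nhdsWithin_le_nhds
      have h3 : Tendsto ĥ (𝓝[univ \ A] a) (𝓝 (h a)) :=
        h2.congr' (eventually_nhdsWithin_of_forall fun b hb ↦ (hĥh hb).symm)
      exact tendsto_nhds_unique h1 h3
    · exact hĥh ⟨mem_univ a, haA⟩
  have hent : Differentiable ℂ h := by
    have : ĥ = h := funext hall
    rw [← this]
    exact fun a ↦ hĥ.differentiableAt univ_mem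
  -- Liouville
  obtain ⟨P, hPdeg, hPeval⟩ := exists_mvPolynomial_of_growth hent (C := max C 0 * 2 ^ K) (K := K) hgrh
  exact ⟨P, hPdeg, fun z hz ↦ by rw [hPeval, ← hfibre z hz]⟩

end Descent
end Summit.HodgeConjecture.HodgeConjecture.Theorems.CyclicUnitaryPowersFermatAffineEigenfunctions

end
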